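import Summits.AtomisticToContinuum.Crystallization.Theorems.HullExactificationCascadeRobustBarlowTemplateDefs
import Summits.AtomisticToContinuum.Crystallization.Theorems.PalmUnimodularRigidityShellsToBarlowChartDefs
import Summits.AtomisticToContinuum.Crystallization.Theorems.PalmUnimodularRigidityShellsToBarlowChartTransportDefs
import Literature.MathematicalPhysics.StatisticalMechanics.BarlowRings

/-!
# Line `registered` (crux `RobustBarlowTemplate`, stmt-AtomisticToContinuum-12088): transport vocabulary

Definitions (D-0016: reviewed; proofs live in the sibling files
`HullExactificationCascadeRobustBarlowTemplate<Stub>.lean`) used to reshape the load-bearing stub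
`stub_develop` of the line `Cruxes/RobustBarlowTemplate/Lines/birth.lean` along the architecture of
the CLOSED sibling crux `ShellsToBarlowChart` (stmt-9227; files
`PalmUnimodularRigidityShellsToBarlowChart{Defs,TransportDefs,DevelopCovering,…}.lean`), with ONE
change: the bond relation is no longer the fixed Euclidean window `(0, 28/25]` (which presupposes
scales in `[9/10, 1]`) but the SCALE-RELATIVE first-shell relation `y ∈ shell S x`
(`dist y x < 13/10 · nnd S x`) of this crux, whose configurations have unbounded scale (only a hard
floor `δ ≤ nnd`).  The model side (`contacts`, `fcc3Int`, `linkOffsets`, `linkAdj`) is imported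
verbatim from the 9227 vocabulary and `BarlowRings.lean`.

* `IsZChart S x P A nbr` — scale-relative INTEGER CHART at `x`: the shell of `x` is labelled
  bijectively by the integer pattern `P ∈ {fcc3Int, hcpInt}` (squared norm `18`), each shell point
  within `nnd S x / 20` of its ideal position `x + (nnd S x/√18) · A t`, and shell-adjacency among
  shell points = label pairs at squared distance `18` (the content of the landed `develop_charts`,
  rewritten over `ℤ³`);
* `TransportSystem S` — three commuting frame transports `I, J, V` with a parity, whose STAR
  clause maps the twelve `linkOffsets` frames bijectively onto `shell S (pt f)` and whose LINK
  clause reads shell-adjacency as `linkAdj` (identical to the 9227 predicate except for the bond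
  relation; the reachability clause is dropped — surjectivity is `stub_exhaust`'s job here);
* `IsShellCovering S s Ψ` — `Ψ` maps the ideal stacking into `S`, the twelve contacts of every
  site bijectively onto the shell of its image (star-bijective), and is faithful on links
  (contacts among contacts ↔ shell-adjacency of images).  Injectivity is NOT asked (it holds for
  no proper quotient only because of the geometry of `S`: stub `develop_injective`).

All `[folklore]` (graph coverings / developing maps for contact graphs of close packings,
specialised to this crux).
-/

noncomputable section

namespace Summit.AtomisticToContinuum.Crystallization.Theorems.HullExactificationCascadeRobustBarlowTemplate

open Literature.MathematicalPhysics.StatisticalMechanics Literature.Geometry.DiscreteGeometry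
open Summit.AtomisticToContinuum.Crystallization.Theorems.PalmUnimodularRigidityShellsToBarlowChart
  (contacts fcc3Int)

/-- Euclidean `3`-space. -/
local notation "E3" => EuclideanSpace ℝ (Fin 3)

/-- **Scale-relative integer chart at `x ∈ S`**: an integer pattern `P` (`fcc3Int` or `hcpInt`,
squared norm `18`), a linear isometry `A` and a labelling `nbr : ℤ³ → ℝ³` mapping `P` bijectively
onto the first shell of `x`, each label `t` landing within `nnd S x / 20` of its ideal position
`x + (nnd S x/√18) · A t`, with shell-adjacency among shell points = label pairs at squared distance
`18`. [folklore] -/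
def IsZChart (S : Set E3) (x : E3) (P : Finset (Fin 3 → ℤ)) (A : E3 →ₗᵢ[ℝ] E3)
    (nbr : (Fin 3 → ℤ) → E3) : Prop :=
  (P = fcc3Int ∨ P = hcpInt) ∧
    Set.BijOn nbr (↑P : Set (Fin 3 → ℤ)) (shell S x) ∧
    (∀ t ∈ P, dist (nbr t) (x + (nnd S x * (Real.sqrt 18)⁻¹) • A (intVec t)) ≤ nnd S x / 20) ∧
    (∀ t ∈ P, ∀ t' ∈ P, (nbr t' ∈ shell S (nbr t) ↔ sqNormInt (t - t') = 18))

/-- **Transport system on `S` (shell version).**  An abstract type of frames `F` with a point map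
`pt : F → S`, three pairwise COMMUTING permutations `I, J, V` of `F` (transport along the two
in-layer generators and to the next layer), a parity `par : F → {1, −1}` invariant under `I` and
`J` (the Hägg letter of the layer of the frame) and a base frame `f₀`, such that STAR: at every
frame `f` the twelve frames `V^r (J^(−Q) (I^(−P) f))`, `(r,P,Q) ∈ linkOffsets (par (V⁻¹ f)) (par f)`,
are mapped by `pt` bijectively onto the first shell of `pt f`, and LINK: one of these twelve points
lies in the first shell of another iff the relative coordinates are `linkAdj`.  (The 9227 predicate
with the bond window replaced by the shell relation and without the reachability clause.)
[folklore] -/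
def TransportSystem (S : Set E3) : Prop :=
  ∃ (F : Type) (pt : F → E3) (I J V : Equiv.Perm F) (par : F → ℤ) (_f₀ : F),
    (∀ f, I (J f) = J (I f)) ∧ (∀ f, I (V f) = V (I f)) ∧ (∀ f, J (V f) = V (J f)) ∧
    (∀ f, pt f ∈ S) ∧
    (∀ f, par f = 1 ∨ par f = -1) ∧ (∀ f, par (I f) = par f) ∧ (∀ f, par (J f) = par f) ∧
    (∀ f, Set.BijOn (fun x : ℤ × ℤ × ℤ => pt ((V ^ x.1) ((J ^ (-x.2.2)) ((I ^ (-x.2.1)) f))))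
        (↑(linkOffsets (par (V⁻¹ f)) (par f)) : Set (ℤ × ℤ × ℤ)) (shell S (pt f))) ∧
    (∀ f, ∀ x ∈ linkOffsets (par (V⁻¹ f)) (par f), ∀ y ∈ linkOffsets (par (V⁻¹ f)) (par f),
        (pt ((V ^ y.1) ((J ^ (-y.2.2)) ((I ^ (-y.2.1)) f))) ∈
            shell S (pt ((V ^ x.1) ((J ^ (-x.2.2)) ((I ^ (-x.2.1)) f)))) ↔
          linkAdj (par (V⁻¹ f)) (par f) x y))

/-- **Shell covering of `S` by the model with Hägg word `s`**: `Ψ` maps the ideal stacking into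
`S`, the contacts of every site bijectively onto the first shell of its image (star-bijective), and
is faithful on links (two contacts of a site touch iff the image of one lies in the first shell of
the image of the other).  Strictly weaker than the crux (it holds for quotients of the model);
injectivity is NOT asked. [folklore] -/
def IsShellCovering (S : Set E3) (s : ℤ → ℤ) (Ψ : E3 → E3) : Prop :=
  Set.MapsTo Ψ (idealStacking s) S ∧
    (∀ p ∈ idealStacking s, Set.BijOn Ψ (contacts s p) (shell S (Ψ p))) ∧
    (∀ p ∈ idealStacking s, ∀ q ∈ contacts s p, ∀ q' ∈ contacts s p,
      (dist q q' = 1 ↔ Ψ q' ∈ shell S (Ψ q)))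

/-- Anchor (registered sub-goal of stmt-AtomisticToContinuum-12088): a shell covering is
shell-closed — the shell of every template point consists of template points. [folklore] -/
theorem shellClosed_of_isShellCovering :
    ∀ (S : Set E3) (s : ℤ → ℤ) (Ψ : E3 → E3), IsShellCovering S s Ψ → ShellClosed S s Ψ := by
  intro S s Ψ h p hp z hz
  obtain ⟨q, hq, rfl⟩ := (h.2.1 p hp).surjOn hz
  exact ⟨q, hq.1, rfl⟩

end Summit.AtomisticToContinuum.Crystallization.Theorems.HullExactificationCascadeRobustBarlowTemplate

end
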